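import Mathlib
import Summits.Schanuel.Schanuel.Theses.ToricSector

/-!
# Line `birth` — BC3 skeleton for the crux `FirstFailureIsToric` (stmt-Schanuel-14712)

Route `ToricSector` (route-Schanuel-ToricSector), crux (rank 6)
`Summit.Schanuel.Schanuel.Theses.ToricSector.FirstFailureIsToric`: if Schanuel holds in every rank
`r < n` and `x ∈ ℂⁿ` is `ℚ`-linearly independent with `trdeg ℚ(x, eˣ) < n` (a FIRST FAILURE at level
`n`), then `x` is TORIC-BAD: the point `p = (x, eˣ) ∈ 𝔾ₘ^{2n}` satisfies `n + 1` `ℤ`-independent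
algebraic Laurent-monomial relations `p^{v_k} ∈ ℚ̄`.

THE LINE (`log-linear sources`). Through the route's own dictionary (`MonomialNormalForm`: a
monomial `∏ xᵢ^{aᵢ} ∏ (e^{xᵢ})^{bᵢ}` is algebraic iff the linear form `Σ aᵢ Log xᵢ + Σ bᵢ xᵢ` lies in
`𝓛 = exp⁻¹(ℚ̄)`, a `ℚ`-subspace of `ℂ` containing `2πiℤ`), toric-badness of `x` says
`dim_ℚ (ℚ⟨x, Log x⟩ + 𝓛)/𝓛 ≤ n − 1`.  Writing `V = ℚ⟨x⟩` (dimension `n`), `k = dim_ℚ (V ∩ 𝓛)` and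
`d = dim_ℚ (ℚ⟨Log x₁, …, Log xₙ⟩ + V + 𝓛)/(V + 𝓛)`, the relation lattice of `p` has rank
`n + k − d`, so TORIC-BAD ⟺ `d ≤ k − 1`.  The monomial relations of a toric-bad point therefore come
from exactly TWO SOURCES, and the skeleton files one stub per source, each in the crux's own
monomial language (no `Complex.log`, no new definition):

* `stub_logInSpan` — SOURCE 1, `k ≥ 1`: the `ℤ`-span of a first failure contains a non-zero
  LOGARITHM OF AN ALGEBRAIC NUMBER: `∃ b ∈ ℤⁿ ∖ 0`, `∏ⱼ (e^{xⱼ})^{bⱼ} = e^{Σ bⱼxⱼ} ∈ ℚ̄`.  One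
  pure-exponential relation `(0, b)`.  A CONSEQUENCE of the crux (rank count: `n + 1` independent
  vectors in `ℤⁿ × ℤⁿ` have a non-trivial combination with vanishing `x`-part), hence not refutable
  short of `¬FirstFailureIsToric`.
* `stub_selfExponential` — SOURCE 2, `d = 0`: every coordinate of a first failure is
  SELF-EXPONENTIAL: `xᵢ^{N} · e^{Σⱼ bᵢⱼ xⱼ} ∈ ℚ̄` for some `N ≠ 0`, i.e. `Log xᵢ ∈ ℚ⟨x⟩ + 𝓛` —
  up to a root of an algebraic factor, `xᵢ` is the exponential of an element of ITS OWN span.  The `n`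
  mixed relations `(N•eᵢ, bᵢ)`.  It is the crux's own shadow in the regime `k = 1`: there
  `FirstFailureIsToric`, applied to every `ℚ`-basis of `V` (first failures are `GL_n(ℚ)`-stable),
  forces `Log v ∈ V + 𝓛` for every `v ∈ V ∖ 0`; and at level `n = 2` the regime `k = 2` (`V ⊂ 𝓛`)
  is excluded by the crux itself (saturation + Baker + unique factorisation in `ℚ̄(T)`, see
  `Lines/birth.md`), so AT LEVEL 2 THE SPLIT IS EXACT:
  `FirstFailureIsToric(2) ⟺ stub_logInSpan(2) ∧ stub_selfExponential(2)`.  (Pointwise, both atom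
  shapes of the route's level-2 census — `TowerAtom` failures `x = (β, c·e^β)`, `Ω` failures with
  some `rᵢ ≠ 0` — satisfy both stubs; but first failures are `GL₂(ℚ)`-stable, and `Lines/birth.md`
  records that the SHEAR `(β + c·e^β, c·e^β)` of a Tower failure violates stub 2 unconditionally, so
  stub 2 at level 2 — like the crux itself — already implies `TowerAtom` and `AlgIndepLogarithms`
  for two logarithms: the crux is far stronger than "Schanuel off the toric sector".)

* `firstFailureIsToric_of_pieces : stub₁-sig → stub₂-sig → ⟨the crux, verbatim⟩` — REAL proof
  (exponent vectors `v₀ = (0, b₀)`, `v_{i+1} = (Nᵢ•eᵢ, bᵢ)`; `ℤ`-linear independence from the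
  block-triangular shape; monomial evaluation by `Fintype.prod_sum_type`), and
  `FirstFailureIsToric_of : FirstFailureIsToric` applies it to the two stubs BY NAME.
* `logInSpan_of_firstFailureIsToric` — sorry-free: the crux implies stub 1 (so stub 1 is EXACTLY as
  safe as the crux).

Neither stub gives the crux alone (stub 1 supplies `k ≥ 1` relations of `x`-part `0`, stub 2 supplies
`n`; toric-badness needs `n + 1`), neither mentions the summit.  Free sharpenings available to stub
provers (landed, `Theorems/MinimalCounterexampleInAcl/Negative/FirstFailureEcl.lean`): a first failure
has `n ≥ 2` (`firstFailure_two_le`), `trdeg = n − 1` exactly (`firstFailure_trdeg_eq`) and all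
coordinates in Kirby's `ecl ∅` (`firstFailure_mem_ecl`, Kirby 2010 Prop. 7.2 = Ax 1971 Thm. 3).

`sorry` occurs ONLY in the two `stub_*` theorems.

References: S. Lang, *Introduction to transcendental numbers* (1966) pp. 30–31 (Schanuel);
J. Kirby, Bull. LMS 42 (2010) §1, Prop. 7.2 (first failures / essential counterexamples);
D. Eisenbud – B. Sturmfels, Duke Math. J. 84 (1996) (binomial ideals = torus translates);
A. Baker, *Transcendental Number Theory* (1975) Ch. 1–2; M. Waldschmidt, *Diophantine approximation
on linear algebraic groups* (2000) §1.4 (the `ℚ`-space `𝓛` of logarithms of algebraic numbers).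
-/

-- `Summit.Schanuel.Schanuel.…`: the duplicated component is the mandated layout of this single-conjunct summit.
set_option linter.dupNamespace false

noncomputable section

namespace Summit.Schanuel.Schanuel.Cruxes.FirstFailureIsToric.Birth

open Summit.Schanuel.Schanuel.Theses.ToricSector
open scoped BigOperators

/-! ## The two registered OPEN stubs -/

/-- **Stub 1 (source 1: a first failure involves a logarithm).**  If Schanuel holds in all ranks
`r < n` and `x ∈ ℂⁿ` is `ℚ`-linearly independent with `trdeg ℚ(x, eˣ) < n`, then some non-zero
integer combination `Σ bⱼ xⱼ` is the logarithm of an algebraic number: `∏ⱼ (e^{xⱼ})^{bⱼ} ∈ ℚ̄`,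
`b ≠ 0` — i.e. `ℚ⟨x⟩ ∩ exp⁻¹(ℚ̄) ≠ 0`, one pure-exponential monomial relation.  A consequence of the
crux (`logInSpan_of_firstFailureIsToric`) and, vacuously, of Schanuel's conjecture; much weaker than
the crux (one relation instead of `n + 1`).  Why it might fail: nothing is known to force a minimal
counterexample to Schanuel to meet the logarithms of algebraic numbers at all (and, first failures
being `GL_n(ℚ)`-stable, it quantifies over every `ℚ`-basis of the span at once).
[cite: Kirby2010EAEF, Prop. 7.2 and §1] -/
theorem stub_logInSpan :
    ∀ (n : ℕ), (∀ r < n, ∀ (z : Fin r → ℂ), LinearIndependent ℚ z →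
        (r : Cardinal) ≤ Algebra.trdeg ℚ
          ↥(IntermediateField.adjoin ℚ (Set.range z ∪ Set.range (Complex.exp ∘ z)))) →
      ∀ (x : Fin n → ℂ), LinearIndependent ℚ x →
        Algebra.trdeg ℚ ↥(IntermediateField.adjoin ℚ (Set.range x ∪ Set.range (Complex.exp ∘ x))) <
          (n : Cardinal) →
        ∃ b : Fin n → ℤ, b ≠ 0 ∧ IsAlgebraic ℚ (∏ j, Complex.exp (x j) ^ (b j)) := by
  sorry

/-- **Stub 2 (source 2: a first failure is coordinatewise self-exponential).**  If Schanuel holds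
in all ranks `r < n` and `x ∈ ℂⁿ` is `ℚ`-linearly independent with `trdeg ℚ(x, eˣ) < n`, then for
every `i` some non-zero power of `xᵢ` is an algebraic number times an exponential of an INTEGER
combination of `x`: `xᵢ^{N} · ∏ⱼ (e^{xⱼ})^{bⱼ} ∈ ℚ̄`, `N ≠ 0` — i.e. `Log xᵢ ∈ ℚ⟨x⟩ + exp⁻¹(ℚ̄)`,
`n` mixed monomial relations.  The crux forces it whenever `dim (ℚ⟨x⟩ ∩ exp⁻¹(ℚ̄)) = 1` (apply the
crux to every `ℚ`-basis of `ℚ⟨x⟩`), and at level `2` unconditionally; the level-2 census shapes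
(`TowerAtom`, `Ω` with some `rᵢ ≠ 0`) all have it.  Vacuous under Schanuel.  Why it might fail: in a
regime `dim (ℚ⟨x⟩ ∩ exp⁻¹(ℚ̄)) ≥ 2` at level `n ≥ 3` it asks for more relations than toric-badness
needs (`d = 0` instead of `d ≤ k − 1`), and, like the crux, no engine produces monomial relations from a
transcendence deficit. [cite: Kirby2010EAEF, Prop. 7.2 and §1] -/
theorem stub_selfExponential :
    ∀ (n : ℕ), (∀ r < n, ∀ (z : Fin r → ℂ), LinearIndependent ℚ z →
        (r : Cardinal) ≤ Algebra.trdeg ℚ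
          ↥(IntermediateField.adjoin ℚ (Set.range z ∪ Set.range (Complex.exp ∘ z)))) →
      ∀ (x : Fin n → ℂ), LinearIndependent ℚ x →
        Algebra.trdeg ℚ ↥(IntermediateField.adjoin ℚ (Set.range x ∪ Set.range (Complex.exp ∘ x))) <
          (n : Cardinal) →
        ∀ i : Fin n, ∃ N : ℤ, N ≠ 0 ∧ ∃ b : Fin n → ℤ,
          IsAlgebraic ℚ (x i ^ N * ∏ j, Complex.exp (x j) ^ (b j)) := by
  sorry

/-! ## Exponent vectors of the line (sorry-free glue) -/

/-- The `n + 1` exponent vectors of the line, as functions `Fin n ⊕ Fin n → ℤ` (first block: exponents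
of `x`, second block: exponents of `eˣ`): row `0` is the pure-exponential relation `(0, b₀)`, row
`i.succ` is the mixed relation `(Nᵢ • eᵢ, bᵢ)`. [folklore] -/
def expVec {n : ℕ} (b₀ : Fin n → ℤ) (N : Fin n → ℤ) (b : Fin n → Fin n → ℤ) :
    Fin (n + 1) → (Fin n ⊕ Fin n → ℤ) :=
  Fin.cases (Sum.elim (0 : Fin n → ℤ) b₀) (fun i => Sum.elim (Pi.single i (N i)) (b i))

/-- Row `0` of `expVec`. [folklore] -/
@[simp] theorem expVec_zero {n : ℕ} (b₀ : Fin n → ℤ) (N : Fin n → ℤ) (b : Fin n → Fin n → ℤ) :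
    expVec b₀ N b 0 = Sum.elim (0 : Fin n → ℤ) b₀ := by
  simp [expVec]

/-- Row `i.succ` of `expVec`. [folklore] -/
@[simp] theorem expVec_succ {n : ℕ} (b₀ : Fin n → ℤ) (N : Fin n → ℤ) (b : Fin n → Fin n → ℤ)
    (i : Fin n) : expVec b₀ N b i.succ = Sum.elim (Pi.single i (N i)) (b i) := by
  simp [expVec]

/-- The exponent vectors are `ℤ`-linearly independent as soon as `b₀ ≠ 0` and every `Nᵢ ≠ 0`
(block-triangular shape: the `x`-block of row `i.succ` is `Nᵢ • eᵢ`, that of row `0` vanishes).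
[folklore] -/
theorem linearIndependent_expVec {n : ℕ} {b₀ : Fin n → ℤ} {N : Fin n → ℤ}
    {b : Fin n → Fin n → ℤ} (hb₀ : b₀ ≠ 0) (hN : ∀ i, N i ≠ 0) :
    LinearIndependent ℤ (expVec b₀ N b) := by
  rw [Fintype.linearIndependent_iff]
  intro g hg
  have key : ∀ p : Fin n ⊕ Fin n, ∑ k, g k * expVec b₀ N b k p = 0 := fun p => by
    have h := congr_fun hg p
    simpa [Finset.sum_apply, Pi.smul_apply, smul_eq_mul] using h
  have hsucc : ∀ j : Fin n, g j.succ = 0 := by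
    intro j
    have h := key (Sum.inl j)
    rw [Fin.sum_univ_succ] at h
    simp only [expVec_zero, expVec_succ, Sum.elim_inl, Pi.zero_apply, mul_zero, zero_add,
      Pi.single_apply, mul_ite] at h
    simp only [Finset.sum_ite_eq, Finset.mem_univ, if_true] at h
    exact (mul_eq_zero.mp h).resolve_right (hN j)
  have hzero : g 0 = 0 := by
    obtain ⟨j, hj⟩ := Function.ne_iff.mp hb₀
    have h := key (Sum.inr j)
    rw [Fin.sum_univ_succ] at h
    simp only [expVec_zero, expVec_succ, Sum.elim_inr, hsucc, zero_mul, Finset.sum_const_zero,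
      add_zero] at h
    exact (mul_eq_zero.mp h).resolve_right hj
  intro k
  exact Fin.cases hzero hsucc k

/-- The monomial of row `0` is the pure-exponential product `∏ⱼ (e^{xⱼ})^{b₀ⱼ}`. [folklore] -/
theorem prod_expVec_zero {n : ℕ} (x : Fin n → ℂ) (b₀ : Fin n → ℤ) (N : Fin n → ℤ)
    (b : Fin n → Fin n → ℤ) :
    ∏ p, Sum.elim x (Complex.exp ∘ x) p ^ (expVec b₀ N b 0 p) =
      ∏ j, Complex.exp (x j) ^ (b₀ j) := by
  rw [Fintype.prod_sum_type]
  simp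

/-- The monomial of row `i.succ` is the mixed product `xᵢ^{Nᵢ} · ∏ⱼ (e^{xⱼ})^{bᵢⱼ}`. [folklore] -/
theorem prod_expVec_succ {n : ℕ} (x : Fin n → ℂ) (b₀ : Fin n → ℤ) (N : Fin n → ℤ)
    (b : Fin n → Fin n → ℤ) (i : Fin n) :
    ∏ p, Sum.elim x (Complex.exp ∘ x) p ^ (expVec b₀ N b i.succ p) =
      x i ^ (N i) * ∏ j, Complex.exp (x j) ^ (b i j) := by
  rw [Fintype.prod_sum_type]
  simp only [expVec_succ, Sum.elim_inl, Sum.elim_inr, Function.comp_apply, Pi.single_apply]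
  congr 1
  rw [Finset.prod_eq_single i]
  · simp
  · intro a _ ha
    simp [ha]
  · simp

/-! ## The composition: the two stubs prove the crux BY NAME -/

/-- **Composition (sorry-free).**  Source 1 gives one relation `(0, b₀)` with `b₀ ≠ 0`, source 2 gives
`n` relations `(Nᵢ • eᵢ, bᵢ)` with `Nᵢ ≠ 0`; together they are `n + 1` `ℤ`-independent exponent vectors
with algebraic monomials, i.e. `x` is toric-bad.  The conclusion is the crux `FirstFailureIsToric`
written out verbatim. [folklore] -/
theorem firstFailureIsToric_of_pieces
    (h₁ : ∀ (n : ℕ), (∀ r < n, ∀ (z : Fin r → ℂ), LinearIndependent ℚ z →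
        (r : Cardinal) ≤ Algebra.trdeg ℚ
          ↥(IntermediateField.adjoin ℚ (Set.range z ∪ Set.range (Complex.exp ∘ z)))) →
      ∀ (x : Fin n → ℂ), LinearIndependent ℚ x →
        Algebra.trdeg ℚ ↥(IntermediateField.adjoin ℚ (Set.range x ∪ Set.range (Complex.exp ∘ x))) <
          (n : Cardinal) →
        ∃ b : Fin n → ℤ, b ≠ 0 ∧ IsAlgebraic ℚ (∏ j, Complex.exp (x j) ^ (b j)))
    (h₂ : ∀ (n : ℕ), (∀ r < n, ∀ (z : Fin r → ℂ), LinearIndependent ℚ z →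
        (r : Cardinal) ≤ Algebra.trdeg ℚ
          ↥(IntermediateField.adjoin ℚ (Set.range z ∪ Set.range (Complex.exp ∘ z)))) →
      ∀ (x : Fin n → ℂ), LinearIndependent ℚ x →
        Algebra.trdeg ℚ ↥(IntermediateField.adjoin ℚ (Set.range x ∪ Set.range (Complex.exp ∘ x))) <
          (n : Cardinal) →
        ∀ i : Fin n, ∃ N : ℤ, N ≠ 0 ∧ ∃ b : Fin n → ℤ,
          IsAlgebraic ℚ (x i ^ N * ∏ j, Complex.exp (x j) ^ (b j))) :
    ∀ (n : ℕ), (∀ r < n, ∀ (z : Fin r → ℂ), LinearIndependent ℚ z →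
        (r : Cardinal) ≤ Algebra.trdeg ℚ
          ↥(IntermediateField.adjoin ℚ (Set.range z ∪ Set.range (Complex.exp ∘ z)))) →
      ∀ (x : Fin n → ℂ), LinearIndependent ℚ x →
        Algebra.trdeg ℚ ↥(IntermediateField.adjoin ℚ (Set.range x ∪ Set.range (Complex.exp ∘ x))) <
          (n : Cardinal) →
        ∃ v : Fin (n + 1) → (Fin n ⊕ Fin n → ℤ), LinearIndependent ℤ v ∧
          ∀ k, IsAlgebraic ℚ (∏ i, Sum.elim x (Complex.exp ∘ x) i ^ (v k i)) := by
  intro n hrank x hx hlt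
  obtain ⟨b₀, hb₀, halg₀⟩ := h₁ n hrank x hx hlt
  choose N hN b halg using h₂ n hrank x hx hlt
  refine ⟨expVec b₀ N b, linearIndependent_expVec hb₀ hN, fun k => ?_⟩
  refine Fin.cases ?_ (fun i => ?_) k
  · rw [prod_expVec_zero]
    exact halg₀
  · rw [prod_expVec_succ]
    exact halg i

/-- **THE SKELETON THEOREM.**  The crux `Summit.Schanuel.Schanuel.Theses.ToricSector.FirstFailureIsToric`,
concluded BY NAME from the two declared stubs. [folklore] -/
theorem FirstFailureIsToric_of : FirstFailureIsToric := by
  intro n hrank x hx hlt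
  exact firstFailureIsToric_of_pieces stub_logInSpan stub_selfExponential n hrank x hx hlt

/-! ## Stub 1 is a consequence of the crux (sorry-free) -/

/-- `a ^ (Σ f) = ∏ a ^ f` for integer exponents and `a ≠ 0`. [folklore] -/
theorem zpow_finset_sum {ι : Type*} {a : ℂ} (ha : a ≠ 0) (f : ι → ℤ) (s : Finset ι) :
    a ^ (∑ i ∈ s, f i) = ∏ i ∈ s, a ^ f i := by
  classical
  induction s using Finset.induction_on with
  | empty => simp
  | insert j s hj ih => rw [Finset.sum_insert hj, Finset.prod_insert hj, zpow_add₀ ha, ih]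

/-- Integer powers of algebraic numbers are algebraic. [folklore] -/
theorem isAlgebraic_zpow {a : ℂ} (ha : IsAlgebraic ℚ a) (m : ℤ) : IsAlgebraic ℚ (a ^ m) := by
  rcases m with (m | m)
  · simpa using ha.pow m
  · rw [zpow_negSucc]
    exact (ha.pow (m + 1)).inv

/-- Finite products of algebraic numbers are algebraic. [folklore] -/
theorem isAlgebraic_finset_prod {ι : Type*} (s : Finset ι) (f : ι → ℂ)
    (hf : ∀ i ∈ s, IsAlgebraic ℚ (f i)) : IsAlgebraic ℚ (∏ i ∈ s, f i) := by
  classical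
  induction s using Finset.induction_on with
  | empty => simpa using isAlgebraic_one
  | insert j s hj ih =>
    rw [Finset.prod_insert hj]
    exact (hf j (Finset.mem_insert_self j s)).mul
      (ih fun i hi => hf i (Finset.mem_insert_of_mem hi))

/-- **The crux implies stub 1.**  From `n + 1` `ℤ`-independent exponent vectors `v_k ∈ ℤⁿ × ℤⁿ` with
algebraic monomials: their `x`-blocks are `n + 1` vectors of `ℤⁿ`, hence `ℤ`-dependent
(`Σ g_k v_k` has `x`-block `0` for some `g ≠ 0`); the combination `c = Σ g_k v_k` is non-zero by
independence, so its `eˣ`-block `b` is non-zero, and `∏ⱼ (e^{xⱼ})^{bⱼ} = ∏_k (p^{v_k})^{g_k}` is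
algebraic. [folklore] -/
theorem logInSpan_of_firstFailureIsToric (h : FirstFailureIsToric) :
    ∀ (n : ℕ), (∀ r < n, ∀ (z : Fin r → ℂ), LinearIndependent ℚ z →
        (r : Cardinal) ≤ Algebra.trdeg ℚ
          ↥(IntermediateField.adjoin ℚ (Set.range z ∪ Set.range (Complex.exp ∘ z)))) →
      ∀ (x : Fin n → ℂ), LinearIndependent ℚ x →
        Algebra.trdeg ℚ ↥(IntermediateField.adjoin ℚ (Set.range x ∪ Set.range (Complex.exp ∘ x))) <
          (n : Cardinal) →
        ∃ b : Fin n → ℤ, b ≠ 0 ∧ IsAlgebraic ℚ (∏ j, Complex.exp (x j) ^ (b j)) := by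
  intro n hrank x hx hlt
  obtain ⟨v, hv, halg⟩ := h n hrank x hx hlt
  -- the `x`-blocks of the `n + 1` vectors are `ℤ`-dependent
  let a : Fin (n + 1) → (Fin n → ℤ) := fun k j => v k (Sum.inl j)
  have ha : ¬ LinearIndependent ℤ a := by
    intro hli
    have hcard := hli.fintype_card_le_finrank
    rw [Module.finrank_fintype_fun_eq_card, Fintype.card_fin, Fintype.card_fin] at hcard
    omega
  obtain ⟨g, hg, k₀, hk₀⟩ := Fintype.not_linearIndependent_iff.mp ha
  -- the combination `c = Σ g_k v_k`
  set c : Fin n ⊕ Fin n → ℤ := ∑ k, g k • v k with hc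
  have hc_apply : ∀ p, c p = ∑ k, g k * v k p := fun p => by
    simp [hc, Finset.sum_apply]
  have hc_inl : ∀ j, c (Sum.inl j) = 0 := fun j => by
    have h0 := congr_fun hg j
    simp only [Finset.sum_apply, Pi.smul_apply, smul_eq_mul, Pi.zero_apply] at h0
    rw [hc_apply]
    simpa [a] using h0
  have hc_ne : c ≠ 0 := by
    intro hc0
    have hall := (Fintype.linearIndependent_iff.mp hv) g (by rw [← hc]; exact hc0)
    exact hk₀ (hall k₀)
  -- its `eˣ`-block is non-zero
  set b : Fin n → ℤ := fun j => c (Sum.inr j) with hb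
  have hb_ne : b ≠ 0 := by
    intro hb0
    apply hc_ne
    funext p
    rcases p with j | j
    · exact hc_inl j
    · exact congr_fun hb0 j
  refine ⟨b, hb_ne, ?_⟩
  -- non-vanishing of the coordinates
  have hS : ∀ p : Fin n ⊕ Fin n, Sum.elim x (Complex.exp ∘ x) p ≠ 0 := by
    rintro (j | j)
    · exact hx.ne_zero j
    · exact Complex.exp_ne_zero _
  -- `∏ⱼ (e^{xⱼ})^{bⱼ} = ∏_p S_p^{c_p} = ∏_k (∏_p S_p^{v_k p})^{g_k}`
  have hprod : ∏ j, Complex.exp (x j) ^ (b j) =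
      ∏ k, (∏ p, Sum.elim x (Complex.exp ∘ x) p ^ (v k p)) ^ (g k) := by
    have h1 : ∏ j, Complex.exp (x j) ^ (b j) = ∏ p, Sum.elim x (Complex.exp ∘ x) p ^ (c p) := by
      rw [Fintype.prod_sum_type]
      simp [hc_inl, hb]
    rw [h1]
    calc ∏ p, Sum.elim x (Complex.exp ∘ x) p ^ (c p)
        = ∏ p, ∏ k, Sum.elim x (Complex.exp ∘ x) p ^ (g k * v k p) := by
          refine Finset.prod_congr rfl fun p _ => ?_
          rw [hc_apply, zpow_finset_sum (hS p)]
      _ = ∏ k, ∏ p, Sum.elim x (Complex.exp ∘ x) p ^ (g k * v k p) := Finset.prod_comm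
      _ = ∏ k, (∏ p, Sum.elim x (Complex.exp ∘ x) p ^ (v k p)) ^ (g k) := by
          refine Finset.prod_congr rfl fun k _ => ?_
          rw [← Finset.prod_zpow]
          refine Finset.prod_congr rfl fun p _ => ?_
          rw [mul_comm, zpow_mul]
  rw [hprod]
  exact isAlgebraic_finset_prod _ _ fun k _ => isAlgebraic_zpow (halg k) (g k)

end Summit.Schanuel.Schanuel.Cruxes.FirstFailureIsToric.Birth

end
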